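import Summits.BirchSwinnertonDyer.BirchSwinnertonDyer.Theorems.ByReductionTypeAtTwoOrdKatoHalfAtTwoIsoGreenbergMuDefs
import Summits.BirchSwinnertonDyer.BirchSwinnertonDyer.Theorems.ByReductionTypeAtTwoOrdKatoHalfAtTwoIsoHintOfAbbesUllmo
import Summits.BirchSwinnertonDyer.Rank1Residual.X5.KatoOrdTwoMuPart
import Literature.NumberTheory.EllipticCurves.NonEisensteinPrimeOfSurjective
import Literature.NumberTheory.EllipticCurves.IsogenyIdProofs
import Literature.Uncategorized.OrdPublishedInputsAtTwo
import Literature.NumberTheory.EllipticCurves.Greenberg1999.TwoTorsionMuInvariant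
import HarnessLib

/-!
# Cert47s1a — crux-triage r1 seat 1/2, GEN 47 (refuter; crux `OrdKatoHalfAtTwoIso`, stmt-BirchSwinnertonDyer-19573)
# VET AT LANDING of w3 GEN 6's `@[conjecture] def …Theorems.SteinbergFibreAtTwo.GreenbergMuZeroTwoOrdPosDisc` (p733065,
# ACCEPTED 2026-08-29T16:39:29Z, commit f17ace6cbf51) = the text the LEAD g10 announced (16:08Z) as the ONE registered
# `0 < Δ` stub G11⁺ of skeleton v24 (ii). ROUTE-FILE-FREE (the K4 `Theses.ByReductionTypeAtTwo` cone is stale on the farm).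

HONEST FRAMING. Evidence for a triage verdict, NOT a Theorems landing, NOT a proof of anything open: BSD is not proved,
crux 202 is not proved, G11⁺ (Greenberg LNM 1716 Conj. 1.11 at `p = 2` on the cell [non-CM · r_an = 0 · good ordinary at 2 ·
ρ̄₂ onto · 0 < Δ], p. 64) is an OPEN published conjecture, displayed as a HYPOTHESIS wherever it occurs below.
What the kernel certifies here:
  (A) `g11Landed_iff_leadText` — the LANDED def is `Iff.rfl` to the LEAD's binder list as this seat copied it VERBATIM in GEN 46
      (`Cert46a.GreenbergConj111TwoOrdOntoPosDisc`, restated below): registering the v24 stub BY NAME of p733065 types.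
  (B) `posDiscText_of_g11Landed` — the LEAD's «direct road» BY THE LANDED NAME: G11⁺ + Abbes–Ullmo + Kato 17.4 (1)(2)@2 (PUB's third
      conjunct) ⟹ the TEXT of the crux's `0 < Δ` conjunct (`PosDiscText`, = `…PosDiscDefs` :149 verbatim) with `W' := W`, through
      LANDED doors only (`O1.katoMuPartAtTwo_of_mu_eq_zero` → `O1.mainConjectureLowerDivisibilityAtTwoOrd_of_katoMuPartAtTwo` with
      `hint_two_of_abbesUllmo_of_irr` → `isIsogenous_self`).
  (C) `isTorsion_of_pub` + `g11Landed_of_printedConj111_of_pub` — the landed monotonicity lemma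
      `greenbergMuZeroTwoOrdPosDisc_of_conj111_two` has TWO hypotheses; the second (Λ-cotorsion of `X(W/ℚ_∞)` on the cell) is
      PRINT = PUB (Kato 17.4 (1) at 2 via modularity, rank-free), discharged here in the kernel; so the registered stub is implied by
      Conj. 1.11 in its PRINTED generality for irreducible `E[2]` ALONE modulo PUB — an honest «published conjecture» stub, not a
      strengthening of print. (¬CM and r_an = 0 binders are idle for torsion.)
-/

set_option autoImplicit false
set_option linter.dupNamespace false

noncomputable section

open scoped Classical MatrixGroups ModularForm
open CongruenceSubgroup WeierstrassCurve Field
open Literature.NumberTheory.GaloisRepresentations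
open Literature.NumberTheory.EllipticCurves Literature.NumberTheory.EllipticCurves.ModularForms
open Literature.NumberTheory.EllipticCurves.Rank1Residual
open Summit.BirchSwinnertonDyer.Rank1Residual Summit.BirchSwinnertonDyer.Rank1Residual.X5
open Summit.BirchSwinnertonDyer.BirchSwinnertonDyer.Theorems.SteinbergFibreAtTwo

namespace Summit.BirchSwinnertonDyer.BirchSwinnertonDyer.Cruxes.OrdKatoHalfAtTwoIso.TriageCert47s1

/-- **The LEAD g10's binder list VERBATIM** (HOME INBOX l.2277, 16:08Z; = `Cert46a.GreenbergConj111TwoOrdOntoPosDisc`).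
Displayed as a hypothesis; nothing asserted. [cite: GreenbergLNM1716, Conj. 1.11 (p. 64)] -/
def LeadG11Text : Prop :=
  ∀ (W : WeierstrassCurve ℚ) [W.IsElliptic] [W.IsGloballyMinimal], ¬ W.HasCM → W.analyticRank = 0 → GoodOrd W 2 →
    W.HasSurjectiveModNGaloisRep 2 → 0 < W.Δ → ∀ (κ : ZpExtension ℚ 2) (γ : absoluteGaloisGroup ℚ),
      κ.IsCyclotomic → κ.IsTopGenerator γ → IsCyclotomicVariable 2 γ → ∀ D : W.SelmerDualData κ γ, D.mu = 0

/-- (A) **The landed def p733065 IS the LEAD's text, by `Iff.rfl`.** [folklore] -/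
theorem g11Landed_iff_leadText : GreenbergMuZeroTwoOrdPosDisc ↔ LeadG11Text := Iff.rfl

/-- The crux's `0 < Δ` conjunct — VERBATIM the body of `Theorems.SteinbergFibreAtTwo.OrdKatoHalfAtTwoIsoPosDisc`
(…OrdKatoHalfAtTwoIsoPosDiscDefs.lean :149–153), restated to stay off the stale route-file cone. -/
def PosDiscText : Prop :=
  ∀ (W : WeierstrassCurve ℚ) [W.IsElliptic] [W.IsGloballyMinimal], ¬ W.HasCM → W.analyticRank = 0 →
    Literature.NumberTheory.EllipticCurves.Rank1Residual.GoodOrd W 2 → W.HasSurjectiveModNGaloisRep 2 → 0 < W.Δ →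
    ∃ (W' : WeierstrassCurve ℚ) (_ : W'.IsElliptic) (_ : W'.IsGloballyMinimal),
      WeierstrassCurve.IsIsogenous W W' ∧
        Summit.BirchSwinnertonDyer.Rank1Residual.X5.O1.MainConjectureLowerDivisibilityAtTwoOrd W'

/-- (B) line 1 — **G11⁺ (landed name) ⇒ Kato's `μ`-part at every curve of the cell.** [cite: GreenbergLNM1716, Conj. 1.11 (p. 64) (shape)] -/
theorem katoMuPartAtTwo_of_g11Landed (hG : GreenbergMuZeroTwoOrdPosDisc) (W : WeierstrassCurve ℚ) [W.IsElliptic]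
    [W.IsGloballyMinimal] (hcm : ¬ W.HasCM) (hr : W.analyticRank = 0) (hgo : GoodOrd W 2)
    (h2 : W.HasSurjectiveModNGaloisRep 2) (hΔ : 0 < W.Δ) : O1.KatoMuPartAtTwo W :=
  O1.katoMuPartAtTwo_of_mu_eq_zero W (hG W hcm hr hgo h2 hΔ)

/-- (B) line 2 — **+ Abbes–Ullmo + Kato 17.4 (1)(2) AT `W` ⇒ `O1.MainConjectureLowerDivisibilityAtTwoOrd W` AT `W`.**
[cite: Kato2004Asterisque, Thm. 17.4 (1)(2) (p. 273)] [cite: AbbesUllmo1996, Thm. A] -/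
theorem mainConjectureLowerDivisibilityAtTwoOrd_of_g11Landed (hG : GreenbergMuZeroTwoOrdPosDisc)
    (hAU : abbesUllmo_not_dvd_maninConstant_of_not_dvd_level) (W : WeierstrassCurve ℚ) [W.IsElliptic]
    [W.IsGloballyMinimal] (hcm : ¬ W.HasCM) (hr : W.analyticRank = 0) (hgo : GoodOrd W 2)
    (h2 : W.HasSurjectiveModNGaloisRep 2) (hΔ : 0 < W.Δ)
    (h17 : ∀ [NeZero (W.conductorNorm ℤ)] (f : CuspForm (Gamma0 (W.conductorNorm ℤ)) 2),
      kato_divisibility_allPrimes W 2 (f := f)) :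
    O1.MainConjectureLowerDivisibilityAtTwoOrd W := by
  haveI : NeZero ((2 : ℕ) : ℚ) := ⟨by norm_num⟩
  exact O1.mainConjectureLowerDivisibilityAtTwoOrd_of_katoMuPartAtTwo W h17
    (fun f hf ϖ hϖ => hint_two_of_abbesUllmo_of_irr hAU W hgo
      (hasIrreducibleModPGaloisRep_of_hasSurjectiveModNGaloisRep W 2 h2) f hf ϖ hϖ)
    (katoMuPartAtTwo_of_g11Landed hG W hcm hr hgo h2 hΔ)

/-- (B) line 3 — **the `0 < Δ` conjunct's TEXT with `W' := W` from {G11⁺ (landed), AU, Kato 17.4 (1)(2)@2}.**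
[cite: Kato2004Asterisque, Thm. 17.4 (1)(2) (p. 273)] -/
theorem posDiscText_of_g11Landed (hG : GreenbergMuZeroTwoOrdPosDisc)
    (hAU : abbesUllmo_not_dvd_maninConstant_of_not_dvd_level)
    (h17 : ∀ (V : WeierstrassCurve ℚ) [V.IsElliptic] [V.IsGloballyMinimal] [NeZero (V.conductorNorm ℤ)]
      (f : CuspForm (Gamma0 (V.conductorNorm ℤ)) 2), kato_divisibility_allPrimes V 2 (f := f)) :
    PosDiscText :=
  fun W _ _ hcm hr hgo h2 hΔ =>
    ⟨W, ‹_›, ‹_›, isIsogenous_self W,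
      mainConjectureLowerDivisibilityAtTwoOrd_of_g11Landed hG hAU W hcm hr hgo h2 hΔ (h17 W)⟩

/-- (B) with the print tier taken from the line's registered `stub_bundle` text (PUB ∧ AU ∧ 5.14@2; 5.14@2 idle here). -/
theorem posDiscText_of_g11Landed_bundle (hG : GreenbergMuZeroTwoOrdPosDisc)
    (hbundle : Literature.Uncategorized.OrdPublishedInputsAtTwo ∧
      abbesUllmo_not_dvd_maninConstant_of_not_dvd_level ∧
        Literature.NumberTheory.EllipticCurves.Greenberg1999.prop514_isTorsion_mu_eq_zero_two) :
    PosDiscText := by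
  obtain ⟨hPub, hAU, -⟩ := hbundle
  obtain ⟨_, _, h17, _⟩ := hPub
  exact posDiscText_of_g11Landed hG hAU h17

/-- (C) **Λ-cotorsion of `X(W/ℚ_∞)` for every normalised cyclotomic dual datum of every globally minimal good-ordinary-at-2
curve is PRINT = PUB**: modularity (PUB conjunct 1) gives the conductor-level newform, Kato 17.4 (1) at 2 (PUB conjunct 3) gives
torsion. Rank-free, CM-free. [cite: Kato2004Asterisque, Thm. 17.4 (1) (p. 273)] [cite: BCDTJAMS2001, Thm. A] -/
theorem isTorsion_of_pub (hPub : Literature.Uncategorized.OrdPublishedInputsAtTwo) (W : WeierstrassCurve ℚ) [W.IsElliptic]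
    [W.IsGloballyMinimal] (hgo : GoodOrd W 2) {κ : ZpExtension ℚ 2} {γ : absoluteGaloisGroup ℚ} (hκ : κ.IsCyclotomic)
    (hγ : κ.IsTopGenerator γ) (hγ' : IsCyclotomicVariable 2 γ) (D : W.SelmerDualData κ γ) : D.IsTorsion := by
  haveI : NeZero (W.conductorNorm ℤ) := ⟨(W.conductorNorm_pos_holds).ne'⟩
  have hord : IsOrdinaryAt W 2 := ⟨hgo.1, hgo.2⟩
  obtain ⟨hmod, _, h17, _⟩ := hPub
  obtain ⟨Dm⟩ := hmod W
  exact (h17 W Dm.f κ γ hκ hγ hγ' hord Dm.isNewformOf D).1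

/-- (C) **The registered-to-be stub G11⁺ follows from Greenberg's Conj. 1.11 at 2 in its PRINTED generality for irreducible `E[2]`
(hypothesis `h`, displayed — OPEN) modulo PUB alone**, through the LANDED monotonicity lemma
`greenbergMuZeroTwoOrdPosDisc_of_conj111_two` with its cotorsion hypothesis discharged by `isTorsion_of_pub`.
[cite: GreenbergLNM1716, Conj. 1.11 (p. 64)] [cite: Kato2004Asterisque, Thm. 17.4 (1) (p. 273)] -/
theorem g11Landed_of_printedConj111_of_pub
    (h : ∀ (W : WeierstrassCurve ℚ) [W.IsElliptic], W.HasIrreducibleModPGaloisRep 2 →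
      ∀ (κ : ZpExtension ℚ 2) (γ : absoluteGaloisGroup ℚ), κ.IsCyclotomic → κ.IsTopGenerator γ →
        ∀ D : W.SelmerDualData κ γ, D.IsTorsion → D.mu = 0)
    (hPub : Literature.Uncategorized.OrdPublishedInputsAtTwo) : GreenbergMuZeroTwoOrdPosDisc :=
  greenbergMuZeroTwoOrdPosDisc_of_conj111_two h
    (fun W _ _ _ _ hgo _ _ hκ hγ hγ' D => isTorsion_of_pub hPub W hgo hκ hγ hγ' D)

/-- (C′) Hence **printed Conj. 1.11@2 (irreducible) + PUB + AU ⟹ the `0 < Δ` conjunct's text** — the whole `0 < Δ` cell of crux 202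
rests on ONE published open conjecture plus print. [cite: GreenbergLNM1716, Conj. 1.11 (p. 64)] -/
theorem posDiscText_of_printedConj111_of_pub
    (h : ∀ (W : WeierstrassCurve ℚ) [W.IsElliptic], W.HasIrreducibleModPGaloisRep 2 →
      ∀ (κ : ZpExtension ℚ 2) (γ : absoluteGaloisGroup ℚ), κ.IsCyclotomic → κ.IsTopGenerator γ →
        ∀ D : W.SelmerDualData κ γ, D.IsTorsion → D.mu = 0)
    (hPub : Literature.Uncategorized.OrdPublishedInputsAtTwo)
    (hAU : abbesUllmo_not_dvd_maninConstant_of_not_dvd_level) : PosDiscText := by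
  obtain ⟨_, _, h17, _⟩ := id hPub
  exact posDiscText_of_g11Landed (g11Landed_of_printedConj111_of_pub h hPub) hAU h17

end Summit.BirchSwinnertonDyer.BirchSwinnertonDyer.Cruxes.OrdKatoHalfAtTwoIso.TriageCert47s1

end
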